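import Literature.Probability.Percolation.NonBacktrackingPathCounting
import HarnessLib

/-!
# PCINT lane, definitions for reduction B3: the chord edges of a step word

Cell `prim-pcint` (PAPER-2 track (iii): certified intervals for `p_c(ℤ^d)`), seat `prim-pcint-2`;
memo `run/shared/lean/prim/pcint/REDUCTIONS.md` §R0, §B3.  Does NOT build on p205010.

For a step word `w` of length `n` (the tree's coding of an `n`-step walk from the origin of `ℤ^d`,
`Literature/Probability/Percolation/SusceptibilityPathCounting.lean`: `wordPos`, `wordEdges`, `IsSAW`,
`sawWords`) the CHORD EDGES are the lattice edges `{v_i, v_j}` joining two visited sites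
`v_i = wordPos w i`, `v_j = wordPos w j` with `i + 2 ≤ j ≤ n`, i.e. not consecutive on the walk.
A shortest open path has all its chord edges closed (`…PcintChordReduction.lean`); the finite-memory
automata of certificate kind `chord_cw` count the chords visible in a window.

* `chordEdges`, `mem_chordEdges`, `chordEdges_subset_edgeSet`;
* `IsSAW.disjoint_wordEdges_chordEdges` — for a self-avoiding word, path edges and chord edges are disjoint.
-/

noncomputable section

namespace Summit.CriticalPhenomena.PercolationContinuityZ3.Theorems.Pcint

open Literature.Probability.Percolation Literature.Probability.LatticeModels

/-! ### Chord edges of a step word -/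

variable {d : ℕ}

open Classical in
/-- The chord edges of a step word `w` of length `n`: the lattice edges `{v_i, v_j}` joining two
visited sites `v_i = wordPos w i`, `v_j = wordPos w j` with `i + 2 ≤ j ≤ n` (not consecutive on
the walk). [folklore] -/
def chordEdges {n : ℕ} (w : Fin n → Fin d × Bool) : Finset (Sym2 (Site d)) :=
  ((Finset.range (n + 1) ×ˢ Finset.range (n + 1)).filter fun ij =>
      ij.1 + 2 ≤ ij.2 ∧ (zdGraph d).Adj (wordPos w ij.1) (wordPos w ij.2)).image
    fun ij => s(wordPos w ij.1, wordPos w ij.2)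

/-- Membership in `chordEdges`. [folklore] -/
theorem mem_chordEdges {n : ℕ} {w : Fin n → Fin d × Bool} {e : Sym2 (Site d)} :
    e ∈ chordEdges w ↔ ∃ i j : ℕ, i + 2 ≤ j ∧ j ≤ n ∧
      (zdGraph d).Adj (wordPos w i) (wordPos w j) ∧ e = s(wordPos w i, wordPos w j) := by
  classical
  constructor
  · intro he
    rw [chordEdges, Finset.mem_image] at he
    obtain ⟨⟨i, j⟩, hij, rfl⟩ := he
    rw [Finset.mem_filter, Finset.mem_product, Finset.mem_range, Finset.mem_range] at hij
    exact ⟨i, j, hij.2.1, by omega, hij.2.2, rfl⟩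
  · rintro ⟨i, j, hij, hjn, hadj, rfl⟩
    rw [chordEdges, Finset.mem_image]
    refine ⟨(i, j), ?_, rfl⟩
    rw [Finset.mem_filter, Finset.mem_product, Finset.mem_range, Finset.mem_range]
    exact ⟨⟨by omega, by omega⟩, hij, hadj⟩

/-- Chord edges are lattice edges. [folklore] -/
theorem chordEdges_subset_edgeSet {n : ℕ} (w : Fin n → Fin d × Bool) :
    (↑(chordEdges w) : Set (Sym2 (Site d))) ⊆ (zdGraph d).edgeSet := by
  intro e he
  obtain ⟨i, j, -, -, hadj, rfl⟩ := mem_chordEdges.1 (Finset.mem_coe.1 he)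
  exact hadj

/-- For a self-avoiding word the path edges and the chord edges are disjoint (a chord joins two
sites that are not consecutive, a path edge two consecutive ones, and the visited sites are
pairwise distinct). [folklore] -/
theorem IsSAW.disjoint_wordEdges_chordEdges {n : ℕ} {w : Fin n → Fin d × Bool} (h : IsSAW w) :
    Disjoint (wordEdges w) (chordEdges w) := by
  classical
  rw [Finset.disjoint_left]
  intro e he hc
  rw [wordEdges, Finset.mem_image] at he
  obtain ⟨k, hk, rfl⟩ := he
  rw [Finset.mem_range] at hk
  obtain ⟨i, j, hij, hjn, -, heq⟩ := mem_chordEdges.1 hc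
  rw [Sym2.eq_iff] at heq
  rcases heq with ⟨h1, h2⟩ | ⟨h1, h2⟩
  · have e1 := h k i hk.le (by omega) h1
    have e2 := h (k + 1) j hk (by omega) h2
    omega
  · have e1 := h k j hk.le (by omega) h1
    have e2 := h (k + 1) i hk (by omega) h2
    omega

end Summit.CriticalPhenomena.PercolationContinuityZ3.Theorems.Pcint
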